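import Summits.AtomisticToContinuum.BoseEinsteinCondensation.Theses.BECDistantTilts
import Summits.AtomisticToContinuum.BoseEinsteinCondensation.Theses.BECSubharmonicContinuation
import Summits.AtomisticToContinuum.BoseEinsteinCondensation.Theses.BECParentAnchor
import Summits.AtomisticToContinuum.BoseEinsteinCondensation.Theses.BECDressedKac
import Summits.AtomisticToContinuum.BoseEinsteinCondensation.Theses.BECSyncSkeleton
import Summits.AtomisticToContinuum.BoseEinsteinCondensation.Theses.BECFisherTransfer
import Literature.MathematicalPhysics.QuantumManyBody.PeriodicBoseGasFracEnergy
import HarnessLib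

/-!
# Birth skeleton (BC3) — crux `PeriodicBEC` (stmt-AtomisticToContinuum-8997) of
# route-AtomisticToContinuum-BECDistantTilts

`Lines/birth.lean` of the crux (registrar unit `skel-stmt-AtomisticToContinuum-8997`). The crux,
concluded BY NAME below:
`Summit.AtomisticToContinuum.BoseEinsteinCondensation.Theses.BECDistantTilts.PeriodicBEC` — for every
repulsive finite-range `v` there is `ρ₀ > 0` such that for `0 < ρ < ρ₀` there is `c > 0` with: for
all large `N` there is `δ > 0` such that every periodic trial state `Ψ` on the torus of side
`L = (N/ρ)^{1/3}` with `periodicEnergy v Ψ ≤ E₀^per(N,L) + δ` has `condensateOccupation N L Ψ ≥ cN`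
(thermodynamic-limit BEC of near-minimisers on the torus; shared item of six routes, consumed by
BECDistantTilts as a black box).

## The line: infrared / ultraviolet split of the depletion in momentum space

Write `n_p = ⟨φ_p, γ_Ψ φ_p⟩ = cellOccupation N L (planeWaveMode L p) Ψ.ψ` for the occupation of the
normalised plane wave of lattice momentum `k = 2πp/L`, `p ∈ ℤ³`, so that `n_0 = condensateOccupation`
(`cellOccupation_planeWaveMode_zero`), `∑_p n_p = N` (`tr γ = N`,
`PeriodicTrialState.tsum_cellOccupation_planeWaveMode`) and `∑_p |k|² n_p = ⟨Ψ, TΨ⟩`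
(`tsum_fracDispersion_two_mul_cellOccupation`), `|k|² = fracDispersion 2 L p`. Fix a cutoff momentum
at the HEALING SCALE, `|k|² = κ²ρ` (`ξ⁻² = 8πρa ∝ ρ` at fixed `v`). The depletion `N - n_0` is the
ultraviolet tail `∑_{|k|² > κ²ρ} n_p` plus the infrared shell `∑_{0 < |k|² ≤ κ²ρ} n_p`:

* `stub_uvTail` — KINETIC LOCALISATION OF THE DEPLETION ABOVE THE HEALING MOMENTUM (provable now,
  M): for every `ε > 0` there is a cutoff `κ` (think `κ² = 16πa/ε`) such that at all small densities,
  for all large `N` and small slack `δ`, every `δ`-near-minimiser has `∑_{|k|² > κ²ρ} n_p ≤ εN`.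
  Mechanism: Chebyshev in momentum, `∑_{|k|²>κ²ρ} n_p ≤ (κ²ρ)⁻¹ ∑_p |k|² n_p ≤ (κ²ρ)⁻¹ (E₀^per + δ)`,
  and the in-tree PROVED Dyson–LSSY upper bound `E₀^per ≤ 4πρ₁a(1 + C a/b)N`
  (`LSSY2005_upperBound_periodic`, `_holds`; `a < ∞` for finite range, `a = 0` harmless). This is the
  kinetic-gap mechanism run exactly where it is legitimate: above an `N`-INDEPENDENT momentum.
* `stub_irShell` — NO INFRARED CATASTROPHE IN THE GROUND STATE (the open heart, XL): there is a
  depletion fraction `θ < 1` such that for EVERY cutoff `κ`, at all small densities (threshold allowed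
  to depend on `κ`), for all large `N`, near-minimisers put at most `θN` particles into the soft
  shell `0 < |k|² ≤ κ²ρ` — `(Lκ√ρ/2π)³ ~ κ³ N √ρ` modes, a vanishing fraction `~ θ'³√(ρa³)` of `N` at
  the healing scale, each of Bogoliubov occupation `~ (|k|ξ)⁻¹ ≫ 1` at the bottom (`|k| = 2π/L`), with
  Bogoliubov shell sum `~ N κ²√(ρa) → 0`. It is STRICTLY WEAKER than the crux as a statement (a
  sub-sum of the depletion, and the crux's `c` may be tiny) yet carries all of its thermodynamic-limit
  difficulty: `Literature.Barriers.AtomisticToContinuum.KineticGapLengthScales` is precisely the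
  statement that energy methods do not bound this shell at `L = (N/ρ)^{1/3}` (the gap `(2π/L)²`
  times the shell occupation is invisible in the energy to the printed orders), and
  `…BogoliubovPerturbationInfrared` that the `T = 0` expansion is marginal there in `d = 3`.
* `PeriodicBEC_of` (kernel-checked, no sorry): `Goal.stub_uvTail → Goal.stub_irShell → PeriodicBEC`
  BY NAME — `θ` from the IR stub, `ε := (1-θ)/2`, `κ` from the UV stub at `ε`, `ρ₀ := min`,
  `c := 1 - θ - ε = (1-θ)/2`, eventually-sets intersected with `N > 0` (so `L > 0`), `δ := min δ₁ δ₂`;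
  then the MODE BOOKKEEPING `condensateOccupation_ge_of_shellBounds`: `tr γ = N` splits pointwise
  into zero mode + shell + tail (`p = 0` is in neither shell nor tail since `fracDispersion 2 L 0 = 0`),
  `ENNReal.tsum_add`, `tsum_eq_single`, and `N = (1-θ-ε)N + (θ+ε)N` cancels the finite part.
  `PeriodicBEC_proof : PeriodicBEC := PeriodicBEC_of stub_uvTail stub_irShell` guards that the
  `Goal.stub_*` audit names are verbatim the registered stubs.

Honest accounting: all open difficulty sits in `stub_irShell`; the cut is the textbook UV/IR
organisation of Bogoliubov theory / infrared-bound proofs (ALSSY-type Gaussian domination bounds the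
same shell mode by mode on the lattice at half filling), typed over the tree's momentum dictionary
(`PeriodicBoseGasFracEnergy`). No `Disproof.lean` exists for this crux (first workfile); the summit's
negatives index has no momentum-shell statement.
-/

noncomputable section

namespace Summit.AtomisticToContinuum.BoseEinsteinCondensation.Cruxes.PeriodicBEC.Birth

open MeasureTheory Filter
open scoped ENNReal Topology BigOperators

/-! ### Registered stubs (the ONLY `sorry`s of this file) -/

/-- **stub UV — kinetic localisation of the depletion above the healing momentum** (M, provable now
from `LSSY2005_upperBound_periodic_holds`, `tsum_fracDispersion_two_mul_cellOccupation` and Chebyshev):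
for every repulsive finite-range `v` and every `ε > 0` there is a cutoff `κ > 0` and a density
threshold `ρ₀ > 0` such that for `0 < ρ < ρ₀`, for all large `N`, for some slack `δ > 0`, every
`δ`-near-minimiser `Ψ` of the periodic energy on the torus of side `L = (N/ρ)^{1/3}` has total
occupation of the plane waves with `|2πp/L|² > κ²ρ` at most `εN`. -/
theorem stub_uvTail :
    ∀ v : ℝ → ENNReal, Literature.MathematicalPhysics.QuantumManyBody.BoseGas.IsRepulsiveFiniteRange v →
      ∀ ε : ℝ, 0 < ε → ∃ κ : ℝ, 0 < κ ∧ ∃ ρ₀ : ℝ, 0 < ρ₀ ∧ ∀ ρ : ℝ, 0 < ρ → ρ < ρ₀ →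
        ∀ᶠ N : ℕ in Filter.atTop, ∃ δ : ENNReal, 0 < δ ∧
          ∀ Ψ : Literature.MathematicalPhysics.QuantumManyBody.BoseGas.PeriodicTrialState N
              (Literature.MathematicalPhysics.QuantumManyBody.BoseGas.sideLength ρ N),
            Literature.MathematicalPhysics.QuantumManyBody.BoseGas.periodicEnergy v Ψ ≤
                Literature.MathematicalPhysics.QuantumManyBody.BoseGas.periodicGroundStateEnergy v N
                    (Literature.MathematicalPhysics.QuantumManyBody.BoseGas.sideLength ρ N) + δ →
              (∑' p : Fin 3 → ℤ,
                  if ENNReal.ofReal (κ ^ 2 * ρ) <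
                      Literature.MathematicalPhysics.QuantumManyBody.BoseGas.fracDispersion 2
                        (Literature.MathematicalPhysics.QuantumManyBody.BoseGas.sideLength ρ N) p then
                    Literature.MathematicalPhysics.QuantumManyBody.BoseGas.cellOccupation N
                      (Literature.MathematicalPhysics.QuantumManyBody.BoseGas.sideLength ρ N)
                      (Literature.MathematicalPhysics.QuantumManyBody.BoseGas.planeWaveMode
                        (Literature.MathematicalPhysics.QuantumManyBody.BoseGas.sideLength ρ N) p) Ψ.ψ
                  else 0) ≤ ENNReal.ofReal (ε * N) := by
  sorry

/-- **stub IR — no infrared catastrophe in the ground state** (XL, the open heart of the crux):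
for every repulsive finite-range `v` there is a depletion fraction `θ ∈ [0, 1)` such that for every
cutoff `κ > 0` there is `ρ₀ > 0` with: for `0 < ρ < ρ₀`, for all large `N`, for some slack `δ > 0`,
every `δ`-near-minimiser `Ψ` on the torus of side `L = (N/ρ)^{1/3}` has total occupation of the SOFT
SHELL `0 < |2πp/L|² ≤ κ²ρ` at most `θN`. (Bogoliubov size of the shell sum: `~ Nκ²√(ρa) → 0`.) -/
theorem stub_irShell :
    ∀ v : ℝ → ENNReal, Literature.MathematicalPhysics.QuantumManyBody.BoseGas.IsRepulsiveFiniteRange v →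
      ∃ θ : ℝ, 0 ≤ θ ∧ θ < 1 ∧ ∀ κ : ℝ, 0 < κ → ∃ ρ₀ : ℝ, 0 < ρ₀ ∧ ∀ ρ : ℝ, 0 < ρ → ρ < ρ₀ →
        ∀ᶠ N : ℕ in Filter.atTop, ∃ δ : ENNReal, 0 < δ ∧
          ∀ Ψ : Literature.MathematicalPhysics.QuantumManyBody.BoseGas.PeriodicTrialState N
              (Literature.MathematicalPhysics.QuantumManyBody.BoseGas.sideLength ρ N),
            Literature.MathematicalPhysics.QuantumManyBody.BoseGas.periodicEnergy v Ψ ≤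
                Literature.MathematicalPhysics.QuantumManyBody.BoseGas.periodicGroundStateEnergy v N
                    (Literature.MathematicalPhysics.QuantumManyBody.BoseGas.sideLength ρ N) + δ →
              (∑' p : Fin 3 → ℤ,
                  if p ≠ 0 ∧
                      Literature.MathematicalPhysics.QuantumManyBody.BoseGas.fracDispersion 2
                        (Literature.MathematicalPhysics.QuantumManyBody.BoseGas.sideLength ρ N) p ≤
                      ENNReal.ofReal (κ ^ 2 * ρ) then
                    Literature.MathematicalPhysics.QuantumManyBody.BoseGas.cellOccupation N
                      (Literature.MathematicalPhysics.QuantumManyBody.BoseGas.sideLength ρ N)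
                      (Literature.MathematicalPhysics.QuantumManyBody.BoseGas.planeWaveMode
                        (Literature.MathematicalPhysics.QuantumManyBody.BoseGas.sideLength ρ N) p) Ψ.ψ
                  else 0) ≤ ENNReal.ofReal (θ * N) := by
  sorry

/-! ### Audit names of the stub statements

`Goal.stub_x : Prop` is VERBATIM the statement of the registered stub `stub_x` above, so that the
skeleton audit (`#h21_check_skeleton`, by-name policy on hypothesis heads) reads the hypotheses of
`PeriodicBEC_of` as exactly the two declared stubs; `PeriodicBEC_proof` below is the kernel-checked
guard that the two copies agree. -/

namespace Goal

/-- Statement of stub UV `stub_uvTail`. -/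
abbrev stub_uvTail : Prop :=
    ∀ v : ℝ → ENNReal, Literature.MathematicalPhysics.QuantumManyBody.BoseGas.IsRepulsiveFiniteRange v →
      ∀ ε : ℝ, 0 < ε → ∃ κ : ℝ, 0 < κ ∧ ∃ ρ₀ : ℝ, 0 < ρ₀ ∧ ∀ ρ : ℝ, 0 < ρ → ρ < ρ₀ →
        ∀ᶠ N : ℕ in Filter.atTop, ∃ δ : ENNReal, 0 < δ ∧
          ∀ Ψ : Literature.MathematicalPhysics.QuantumManyBody.BoseGas.PeriodicTrialState N
              (Literature.MathematicalPhysics.QuantumManyBody.BoseGas.sideLength ρ N),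
            Literature.MathematicalPhysics.QuantumManyBody.BoseGas.periodicEnergy v Ψ ≤
                Literature.MathematicalPhysics.QuantumManyBody.BoseGas.periodicGroundStateEnergy v N
                    (Literature.MathematicalPhysics.QuantumManyBody.BoseGas.sideLength ρ N) + δ →
              (∑' p : Fin 3 → ℤ,
                  if ENNReal.ofReal (κ ^ 2 * ρ) <
                      Literature.MathematicalPhysics.QuantumManyBody.BoseGas.fracDispersion 2
                        (Literature.MathematicalPhysics.QuantumManyBody.BoseGas.sideLength ρ N) p then
                    Literature.MathematicalPhysics.QuantumManyBody.BoseGas.cellOccupation N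
                      (Literature.MathematicalPhysics.QuantumManyBody.BoseGas.sideLength ρ N)
                      (Literature.MathematicalPhysics.QuantumManyBody.BoseGas.planeWaveMode
                        (Literature.MathematicalPhysics.QuantumManyBody.BoseGas.sideLength ρ N) p) Ψ.ψ
                  else 0) ≤ ENNReal.ofReal (ε * N)

/-- Statement of stub IR `stub_irShell`. -/
abbrev stub_irShell : Prop :=
    ∀ v : ℝ → ENNReal, Literature.MathematicalPhysics.QuantumManyBody.BoseGas.IsRepulsiveFiniteRange v →
      ∃ θ : ℝ, 0 ≤ θ ∧ θ < 1 ∧ ∀ κ : ℝ, 0 < κ → ∃ ρ₀ : ℝ, 0 < ρ₀ ∧ ∀ ρ : ℝ, 0 < ρ → ρ < ρ₀ →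
        ∀ᶠ N : ℕ in Filter.atTop, ∃ δ : ENNReal, 0 < δ ∧
          ∀ Ψ : Literature.MathematicalPhysics.QuantumManyBody.BoseGas.PeriodicTrialState N
              (Literature.MathematicalPhysics.QuantumManyBody.BoseGas.sideLength ρ N),
            Literature.MathematicalPhysics.QuantumManyBody.BoseGas.periodicEnergy v Ψ ≤
                Literature.MathematicalPhysics.QuantumManyBody.BoseGas.periodicGroundStateEnergy v N
                    (Literature.MathematicalPhysics.QuantumManyBody.BoseGas.sideLength ρ N) + δ →
              (∑' p : Fin 3 → ℤ,
                  if p ≠ 0 ∧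
                      Literature.MathematicalPhysics.QuantumManyBody.BoseGas.fracDispersion 2
                        (Literature.MathematicalPhysics.QuantumManyBody.BoseGas.sideLength ρ N) p ≤
                      ENNReal.ofReal (κ ^ 2 * ρ) then
                    Literature.MathematicalPhysics.QuantumManyBody.BoseGas.cellOccupation N
                      (Literature.MathematicalPhysics.QuantumManyBody.BoseGas.sideLength ρ N)
                      (Literature.MathematicalPhysics.QuantumManyBody.BoseGas.planeWaveMode
                        (Literature.MathematicalPhysics.QuantumManyBody.BoseGas.sideLength ρ N) p) Ψ.ψ
                  else 0) ≤ ENNReal.ofReal (θ * N)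

end Goal

/-! ### Proved glue (no `sorry` below this line) -/

section Glue

open Literature.MathematicalPhysics.QuantumManyBody.BoseGas

/-- **Mode bookkeeping** (the Penrose–Onsager count in momentum space): on a torus of side `L > 0`,
if the plane waves with `|k|² > A` carry at most `εN` particles of the periodic trial state `Ψ` and
the soft shell `0 < |k|² ≤ A` at most `θN`, then, because `tr γ_Ψ = ∑_p n_p = N` and `n_0` is the
condensate occupation, `condensateOccupation N L Ψ ≥ (1 - θ - ε) N`. [cite: LSSY2005, §1.2 (1.18)] -/
theorem condensateOccupation_ge_of_shellBounds {N : ℕ} {L : ℝ} (hL : 0 < L)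
    (Ψ : PeriodicTrialState N L) (A : ℝ≥0∞) {θ ε : ℝ} (hθ : 0 ≤ θ) (hε : 0 ≤ ε) (hθε : θ + ε ≤ 1)
    (hUV : (∑' p : Fin 3 → ℤ, if A < fracDispersion 2 L p then
        cellOccupation N L (planeWaveMode L p) Ψ.ψ else 0) ≤ ENNReal.ofReal (ε * N))
    (hIR : (∑' p : Fin 3 → ℤ, if p ≠ 0 ∧ fracDispersion 2 L p ≤ A then
        cellOccupation N L (planeWaveMode L p) Ψ.ψ else 0) ≤ ENNReal.ofReal (θ * N)) :
    ENNReal.ofReal ((1 - θ - ε) * N) ≤ condensateOccupation N L Ψ.ψ := by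
  -- Parseval in the traced variable: `tr γ = N`
  have hP : ∑' p : Fin 3 → ℤ, cellOccupation N L (planeWaveMode L p) Ψ.ψ = N :=
    Ψ.tsum_cellOccupation_planeWaveMode hL
  -- pointwise three-way split: zero mode + soft shell + tail
  have hpt : ∀ p : Fin 3 → ℤ, cellOccupation N L (planeWaveMode L p) Ψ.ψ =
      (if p = 0 then cellOccupation N L (planeWaveMode L p) Ψ.ψ else 0) +
        ((if p ≠ 0 ∧ fracDispersion 2 L p ≤ A then cellOccupation N L (planeWaveMode L p) Ψ.ψ else 0) +
          (if A < fracDispersion 2 L p then cellOccupation N L (planeWaveMode L p) Ψ.ψ else 0)) := by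
    intro p
    by_cases hp : p = 0
    · subst hp
      have h0 : ¬ A < fracDispersion 2 L 0 := by
        rw [fracDispersion_zero two_ne_zero]
        exact ENNReal.not_lt_zero
      rw [if_pos rfl, if_neg (fun h => h.1 rfl), if_neg h0, add_zero, add_zero]
    · rw [if_neg hp, zero_add]
      by_cases hle : fracDispersion 2 L p ≤ A
      · rw [if_pos ⟨hp, hle⟩, if_neg (not_lt.2 hle), add_zero]
      · rw [if_neg (fun h => hle h.2), if_pos (not_le.1 hle), zero_add]
  -- the zero-mode term is a single-support series summing to the condensate occupation
  have hzero : (∑' p : Fin 3 → ℤ, if p = 0 then cellOccupation N L (planeWaveMode L p) Ψ.ψ else 0) =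
      condensateOccupation N L Ψ.ψ := by
    rw [tsum_eq_single (0 : Fin 3 → ℤ) (fun p hp => if_neg hp), if_pos rfl,
      cellOccupation_planeWaveMode_zero]
  -- sum the split
  have hmain : (N : ℝ≥0∞) ≤ condensateOccupation N L Ψ.ψ +
      (ENNReal.ofReal (θ * N) + ENNReal.ofReal (ε * N)) := by
    calc (N : ℝ≥0∞) = ∑' p : Fin 3 → ℤ, cellOccupation N L (planeWaveMode L p) Ψ.ψ := hP.symm
      _ = ∑' p : Fin 3 → ℤ, ((if p = 0 then cellOccupation N L (planeWaveMode L p) Ψ.ψ else 0) +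
            ((if p ≠ 0 ∧ fracDispersion 2 L p ≤ A then cellOccupation N L (planeWaveMode L p) Ψ.ψ else 0) +
              (if A < fracDispersion 2 L p then cellOccupation N L (planeWaveMode L p) Ψ.ψ else 0))) :=
          tsum_congr hpt
      _ = (∑' p : Fin 3 → ℤ, if p = 0 then cellOccupation N L (planeWaveMode L p) Ψ.ψ else 0) +
            ((∑' p : Fin 3 → ℤ,
                if p ≠ 0 ∧ fracDispersion 2 L p ≤ A then cellOccupation N L (planeWaveMode L p) Ψ.ψ else 0) +
              (∑' p : Fin 3 → ℤ,
                if A < fracDispersion 2 L p then cellOccupation N L (planeWaveMode L p) Ψ.ψ else 0)) := by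
          rw [ENNReal.tsum_add, ENNReal.tsum_add]
      _ ≤ condensateOccupation N L Ψ.ψ + (ENNReal.ofReal (θ * N) + ENNReal.ofReal (ε * N)) := by
          rw [hzero]
          exact add_le_add le_rfl (add_le_add hIR hUV)
  -- cancel the finite part `(θ + ε) N`
  have hT : ENNReal.ofReal (θ * N) + ENNReal.ofReal (ε * N) = ENNReal.ofReal ((θ + ε) * N) := by
    rw [add_mul, ENNReal.ofReal_add (mul_nonneg hθ N.cast_nonneg) (mul_nonneg hε N.cast_nonneg)]
  have hN : (N : ℝ≥0∞) = ENNReal.ofReal ((1 - θ - ε) * N) + ENNReal.ofReal ((θ + ε) * N) := by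
    rw [← ENNReal.ofReal_add (mul_nonneg (by linarith) N.cast_nonneg)
      (mul_nonneg (by linarith) N.cast_nonneg), ← add_mul]
    have h1 : (1 - θ - ε + (θ + ε)) = 1 := by ring
    rw [h1, one_mul, ENNReal.ofReal_natCast]
  rw [hT] at hmain
  rw [hN] at hmain
  exact ENNReal.le_of_add_le_add_right ENNReal.ofReal_ne_top hmain

end Glue

/-! ### The assembly: stubs ⟹ the crux, BY NAME -/

open Literature.MathematicalPhysics.QuantumManyBody.BoseGas in
/-- **The composition** `stub_uvTail → stub_irShell → PeriodicBEC` (the route decl, BY NAME;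
hypotheses by their audit names `Goal.stub_*`, verbatim the stub statements). Fix `v`; `θ < 1` from
the IR stub (uniform in the cutoff); `ε := (1 - θ)/2`; the UV stub at `ε` gives the cutoff `κ` and a
threshold `ρ₁`; the IR stub at `κ` gives `ρ₂`; `ρ₀ := min ρ₁ ρ₂`, `c := 1 - θ - ε = (1 - θ)/2 > 0`;
intersect the two eventually-sets with `N > 0` (so `L > 0`), `δ := min δ₁ δ₂`, and conclude by the mode
bookkeeping with `A := κ²ρ`. -/
theorem PeriodicBEC_of :
    Goal.stub_uvTail → Goal.stub_irShell →
      Summit.AtomisticToContinuum.BoseEinsteinCondensation.Theses.BECDistantTilts.PeriodicBEC := by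
  intro hUV hIR v hv
  obtain ⟨θ, hθ0, hθ1, hIRκ⟩ := hIR v hv
  have hεpos : 0 < (1 - θ) / 2 := by linarith
  obtain ⟨κ, hκ, ρ₁, hρ₁, hUVρ⟩ := hUV v hv ((1 - θ) / 2) hεpos
  obtain ⟨ρ₂, hρ₂, hIRρ⟩ := hIRκ κ hκ
  refine ⟨min ρ₁ ρ₂, lt_min hρ₁ hρ₂, fun ρ hρ hρlt => ?_⟩
  have hρ1 : ρ < ρ₁ := lt_of_lt_of_le hρlt (min_le_left _ _)
  have hρ2 : ρ < ρ₂ := lt_of_lt_of_le hρlt (min_le_right _ _)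
  refine ⟨1 - θ - (1 - θ) / 2, by linarith, ?_⟩
  filter_upwards [hUVρ ρ hρ hρ1, hIRρ ρ hρ hρ2, Filter.eventually_gt_atTop 0] with N hNuv hNir hNpos
  obtain ⟨δ₁, hδ₁, h1⟩ := hNuv
  obtain ⟨δ₂, hδ₂, h2⟩ := hNir
  refine ⟨min δ₁ δ₂, lt_min hδ₁ hδ₂, fun Ψ hΨ => ?_⟩
  have hL : 0 < sideLength ρ N :=
    Real.rpow_pos_of_pos (div_pos (Nat.cast_pos.mpr hNpos) hρ) _
  have hΨ1 := h1 Ψ (hΨ.trans (add_le_add le_rfl (min_le_left _ _)))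
  have hΨ2 := h2 Ψ (hΨ.trans (add_le_add le_rfl (min_le_right _ _)))
  exact condensateOccupation_ge_of_shellBounds hL Ψ (ENNReal.ofReal (κ ^ 2 * ρ)) hθ0 hεpos.le
    (by linarith) hΨ1 hΨ2

/-- The skeleton as a (sorried-through-the-stubs) proof of the crux (D-0027 §3.3 shape): `_of`
applied to the two `stub_*` theorems — also the kernel-checked guard that their verbatim types are
the `Goal.stub_*` statements. -/
theorem PeriodicBEC_proof :
    Summit.AtomisticToContinuum.BoseEinsteinCondensation.Theses.BECDistantTilts.PeriodicBEC :=
  PeriodicBEC_of stub_uvTail stub_irShell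

/-! ### Shared-crux aliases (item stmt-AtomisticToContinuum-8997 is ONE ledger item wanted by six routes)

The five other route files declare the same proposition verbatim (byte-identical bodies, checked
2026-08-17), so the skeleton concludes each of their decls BY NAME as well, by definitional unfolding
of the two `def`s — whichever route decl `ledger skeleton check --crux stmt-AtomisticToContinuum-8997`
resolves to (default: the first `wanted_by`, `BECSubharmonicContinuation.PeriodicBEC`), a hypothesis-free
theorem of this file concludes it. -/

/-- The skeleton concludes `BECSubharmonicContinuation.PeriodicBEC` (same item 8997) by name. -/
theorem PeriodicBEC_proof_BECSubharmonicContinuation :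
    Summit.AtomisticToContinuum.BoseEinsteinCondensation.Theses.BECSubharmonicContinuation.PeriodicBEC :=
  PeriodicBEC_proof

/-- The skeleton concludes `BECParentAnchor.PeriodicBEC` (same item 8997) by name. -/
theorem PeriodicBEC_proof_BECParentAnchor :
    Summit.AtomisticToContinuum.BoseEinsteinCondensation.Theses.BECParentAnchor.PeriodicBEC :=
  PeriodicBEC_proof

/-- The skeleton concludes `BECDressedKac.PeriodicBEC` (same item 8997) by name. -/
theorem PeriodicBEC_proof_BECDressedKac :
    Summit.AtomisticToContinuum.BoseEinsteinCondensation.Theses.BECDressedKac.PeriodicBEC :=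
  PeriodicBEC_proof

/-- The skeleton concludes `BECSyncSkeleton.PeriodicCondensation` (same item 8997) by name. -/
theorem PeriodicBEC_proof_BECSyncSkeleton :
    Summit.AtomisticToContinuum.BoseEinsteinCondensation.Theses.BECSyncSkeleton.PeriodicCondensation :=
  PeriodicBEC_proof

/-- The skeleton concludes `BECFisherTransfer.PeriodicBec` (same item 8997) by name. -/
theorem PeriodicBEC_proof_BECFisherTransfer :
    Summit.AtomisticToContinuum.BoseEinsteinCondensation.Theses.BECFisherTransfer.PeriodicBec :=
  PeriodicBEC_proof

end Summit.AtomisticToContinuum.BoseEinsteinCondensation.Cruxes.PeriodicBEC.Birth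

end
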